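import Summits.BirchSwinnertonDyer.BirchSwinnertonDyer.Theorems.ResidualThetaTransportAtTwoThetaLayerLambdaCongruenceAtTwoCuspSpanFourInvariance
import HarnessLib

/-!
# Route `ResidualThetaTransportAtTwo`, cruxes Kan⁺ (stmt-BirchSwinnertonDyer-20688) / 21437: 4-invariance of the `B₁`-character at
# ANY odd level from an arithmetic witness, and UNCONDITIONALLY at every odd PRIME-POWER level (two Dirichlet primes)

Cell `bsd-wall`, lead prover `bsd-wall-rtt-p3` g9 (2026-08-28). THEOREMS ONLY; `--supports stmt-BirchSwinnertonDyer-20688`; BSD is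
not proved by this. Sequel of `…CuspSpanFourInvariance` (prime level).

* §1 `chi_eq_of_b_neg_one_of_witness` (any level `N` prime to `4`): if `d(β) d(β') ≡ −4`, and there are an integer `δ ≡ d(β)
  (mod N)` and `k ≥ 1` with `δ ∣ 4^k − 1` and `4^k ≡ 4 (mod N)`, then `χ β = χ β'` (the matrix part of the prime-level proof:
  `β₁ = (α₁, −1; Nκ₁, δ)`, `β₂ = (α₂, −1; Nκ₂, −m₀ − α₁)`, `β₁β₂` has lower-right entry `−4^k`).
* §2 `exists_prime_modEq_pair`: a prime in prescribed classes mod two coprime moduli (CRT + Dirichlet, Mathlib `PrimesInAP`).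
* §3 `chi_eq_of_b_neg_one_of_mul_d_eq_neg_four_primePow` / `chi_eq_of_b_neg_one_of_d_eq_four_mul_primePow`: at `N = p^e`, `p`
  an odd prime, `F(u) = F(−4/u)` and `F(4u) = F(u)` for EVERY unit `u`. Witness: if `u ≢ 1 (mod p)` one prime
  `q ≡ −1 (mod 4(p−1))`, `q ≡ u (mod p^e)` (then `(q−1)/2` is prime to `φ(p^e) = p^{e−1}(p−1)`); if `u ≡ 1 (mod p)` two such primes
  in the classes `2` and `u/2` (both `≢ 1 (mod p)`), `δ = q₁q₂`; `k := E·s` with `E = ∏ (qᵢ−1)/2`, `E s ≡ 1 (mod φ(p^e))`, so that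
  `4^k ≡ 4` (Euler) and `qᵢ ∣ 4^E − 1 ∣ 4^k − 1` (Fermat).

References: [Rademacher1929] §1; [Pollack2003] Conj. 6.3; Dirichlet / Mathlib `Nat.forall_exists_prime_gt_and_modEq`.
-/

set_option autoImplicit false
set_option linter.dupNamespace false

open scoped MatrixGroups

open CongruenceSubgroup

namespace Summit.BirchSwinnertonDyer.BirchSwinnertonDyer.Theorems.SignedMuAtTwo

/-! ## §1. The witness form (any level prime to `4`) -/

section Witness

variable {N : ℕ} {χ : Gamma0 N → ZMod 2}

/-- **`F(u) = F(−4/u)` from an arithmetic witness** (`δ ≡ u`, `δ ∣ 4^k − 1`, `4^k ≡ 4 (mod N)`, `k ≥ 1`, `N` prime to `4`).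
[cite: Pollack2003, Conj. 6.3] -/
theorem chi_eq_of_b_neg_one_of_witness (hN4 : IsCoprime (4 : ℤ) N)
    (hadd : ∀ γ δ : Gamma0 N, χ (γ * δ) = χ γ + χ δ)
    (hsmall : ∀ γ : Gamma0 N, ((γ : SL(2, ℤ)) 0 0 + (γ : SL(2, ℤ)) 1 1).natAbs ≤ 2 → χ γ = 0)
    (hkill : ∀ γ : Gamma0 N, (∃ k : ℕ, 1 ≤ k ∧ ((γ : SL(2, ℤ)) 1 1).natAbs = 4 ^ k) → χ γ = 0)
    {β β' : Gamma0 N} (hb : (β : SL(2, ℤ)) 0 1 = -1) (hb' : (β' : SL(2, ℤ)) 0 1 = -1)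
    (h : ((((β : SL(2, ℤ)) 1 1 : ℤ) : ZMod N)) * ((((β' : SL(2, ℤ)) 1 1 : ℤ) : ZMod N)) = -4)
    (δ : ℤ) (hδ : ((δ : ℤ) : ZMod N) = ((((β : SL(2, ℤ)) 1 1 : ℤ) : ZMod N))) (k : ℕ) (hk : 1 ≤ k)
    (hδk : δ ∣ 4 ^ k - 1) (hNk : ((4 : ZMod N)) ^ k = 4) : χ β = χ β' := by
  have hdu : IsUnit ((δ : ℤ) : ZMod N) := hδ ▸ isUnit_gamma0_apply_one_one β
  obtain ⟨α₁, κ₁, h1⟩ : IsCoprime δ (N : ℤ) := ((ZMod.coe_int_isUnit_iff_isCoprime δ N).mp hdu).symm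
  obtain ⟨β₁, -, h101, h110, h111⟩ := ThetaLayerLambdaCongruenceAtTwo.exists_gamma0_entries (N := N)
    α₁ (-1) (N * κ₁) δ (by linear_combination h1) (dvd_mul_right _ _)
  obtain ⟨m₀, hm₀⟩ := hδk
  set δ₂ : ℤ := -m₀ - α₁ with hδ₂
  have hqδ : δ * δ₂ = -4 ^ k + κ₁ * N := by
    rw [hδ₂]; linear_combination hm₀ - h1
  have hcopδ : IsCoprime δ₂ (N : ℤ) := by
    have e1 : IsCoprime (δ * δ₂) N := by
      rw [hqδ]; exact ((hN4.pow_left (m := k)).neg_left).add_mul_right_left κ₁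
    exact e1.of_mul_left_right
  obtain ⟨α₂, κ₂, h2⟩ := hcopδ
  obtain ⟨β₂, -, h201, -, h211⟩ := ThetaLayerLambdaCongruenceAtTwo.exists_gamma0_entries (N := N)
    α₂ (-1) (N * κ₂) δ₂ (by linear_combination h2) (dvd_mul_right _ _)
  have hprod : ((β₁ * β₂ : Gamma0 N) : SL(2, ℤ)) 1 1 = -4 ^ k := by
    rw [gamma0_mul_apply_one_one', h110, h201, h111, h211]; linear_combination hqδ
  have hkilled : χ (β₁ * β₂) = 0 :=
    hkill _ ⟨k, hk, by rw [hprod, Int.natAbs_neg, Int.natAbs_pow]; rfl⟩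
  have h12 : χ β₁ = χ β₂ := by
    rw [hadd] at hkilled
    have e1 : χ β₁ = -χ β₂ := by linear_combination hkilled
    rw [e1, ZMod.neg_eq_self_mod_two]
  have hres1 : ((((β₁ : SL(2, ℤ)) 1 1 : ℤ) : ZMod N)) = ((((β : SL(2, ℤ)) 1 1 : ℤ) : ZMod N)) := by rw [h111, hδ]
  have hres2 : ((((β : SL(2, ℤ)) 1 1 : ℤ) : ZMod N)) * (((δ₂ : ℤ) : ZMod N)) = -4 := by
    rw [← hδ]
    have e1 := congrArg (Int.cast : ℤ → ZMod N) hqδ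
    push_cast at e1
    rw [e1, hNk, ZMod.natCast_self, mul_zero, add_zero]
  have hres3 : ((((β' : SL(2, ℤ)) 1 1 : ℤ) : ZMod N)) = ((((β₂ : SL(2, ℤ)) 1 1 : ℤ) : ZMod N)) := by
    rw [h211]
    exact (isUnit_gamma0_apply_one_one β).mul_left_cancel (h.trans hres2.symm)
  rw [chi_eq_of_apply_zero_one_eq_neg_one hadd hsmall hb h101 hres1.symm, h12,
    ← chi_eq_of_apply_zero_one_eq_neg_one hadd hsmall hb' h201 hres3]

end Witness

/-! ## §2. A Dirichlet prime in two prescribed classes -/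

/-- A prime `q > n₀` with `q ≡ M − 1 (mod M)` and `q ≡ c (mod N)`, for coprime moduli `M, N ≥ 1` and `c` prime to `N`
(CRT + Dirichlet). [folklore] -/
theorem exists_prime_modEq_pair (M N c n₀ : ℕ) (hM : 1 ≤ M) (hN : 1 ≤ N) (hMN : Nat.Coprime M N) (hc : Nat.Coprime c N) :
    ∃ q : ℕ, n₀ < q ∧ q.Prime ∧ q ≡ M - 1 [MOD M] ∧ q ≡ c [MOD N] := by
  obtain ⟨k0, hk0M, hk0N⟩ := Nat.chineseRemainder hMN (M - 1) c
  have hk0cop : Nat.Coprime k0 (M * N) := by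
    apply Nat.Coprime.mul_right
    · have h' : Nat.Coprime (M - 1) (M - 1 + 1) := Nat.coprime_self_add_right.mpr (Nat.coprime_one_right _)
      rw [Nat.sub_add_cancel hM] at h'
      show Nat.gcd k0 M = 1
      rw [hk0M.gcd_eq]; exact h'
    · show Nat.gcd k0 N = 1
      rw [hk0N.gcd_eq]; exact hc
  obtain ⟨q, hq, hqprime, hqmod⟩ := Nat.forall_exists_prime_gt_and_modEq n₀ (q := M * N) (a := k0)
    (Nat.mul_ne_zero (by omega) (by omega)) hk0cop
  exact ⟨q, hq, hqprime, (hqmod.of_mul_right N).trans hk0M, (hqmod.of_mul_left M).trans hk0N⟩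

/-- From `q ≡ M − 1 (mod M)` with `M = 4L`: `q` is odd and `(q − 1)/2 ≡ −1 (mod 2L)`, so `(q−1)/2` is prime to `L`; and a prime
`r` with `q ≢ 1 (mod r)` does not divide `(q−1)/2`. Packaged: `Nat.Coprime ((q−1)/2) L`. [folklore] -/
theorem coprime_half_pred_of_modEq (L q : ℕ) (hL : 1 ≤ L) (hq : q ≡ 4 * L - 1 [MOD 4 * L]) (hq1 : 1 ≤ q) :
    Nat.Coprime ((q - 1) / 2) L ∧ q = 2 * ((q - 1) / 2) + 1 := by
  have hdvd : 4 * L ∣ q + 1 := by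
    have e : q + 1 ≡ 4 * L - 1 + 1 [MOD 4 * L] := hq.add_right 1
    rw [Nat.sub_add_cancel (by omega)] at e
    exact Nat.modEq_zero_iff_dvd.mp (e.trans (Nat.modEq_zero_iff_dvd.mpr dvd_rfl))
  obtain ⟨j, hj⟩ := hdvd
  have hj1 : 1 ≤ j := by
    rcases Nat.eq_zero_or_pos j with h0 | h0
    · rw [h0, mul_zero] at hj; omega
    · exact h0
  have hLj : 1 ≤ L * j := Nat.one_le_iff_ne_zero.mpr (Nat.mul_ne_zero (by omega) (by omega))
  have h4 : 4 * L * j = 4 * (L * j) := by ring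
  have he : (q - 1) / 2 = 2 * (L * j) - 1 := by omega
  refine ⟨?_, by omega⟩
  rw [he]
  have h' : Nat.Coprime (2 * (L * j) - 1) (2 * (L * j) - 1 + 1) := Nat.coprime_self_add_right.mpr (Nat.coprime_one_right _)
  rw [Nat.sub_add_cancel (by omega)] at h'
  -- `Coprime (2Lj − 1) (2Lj)` ⇒ `Coprime (2Lj − 1) L`
  exact Nat.Coprime.coprime_dvd_right ⟨2 * j, by ring⟩ h'

/-! ## §3. Prime powers -/

section PrimePow

variable {p e : ℕ} [NeZero (p ^ e)] {χ : Gamma0 (p ^ e) → ZMod 2}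

/-- Fermat at an auxiliary odd prime `q`: `q ∣ 4^{((q−1)/2)·t} − 1`. [folklore] -/
theorem int_prime_dvd_four_pow_sub_one {q : ℕ} (hq : q.Prime) (hq2 : 2 < q) (E t : ℕ) (hE : q = 2 * E + 1) :
    (q : ℤ) ∣ 4 ^ (E * t) - 1 := by
  haveI : Fact q.Prime := ⟨hq⟩
  have h2q : (2 : ZMod q) ≠ 0 := by
    intro h0
    have h0' : ((2 : ℕ) : ZMod q) = 0 := by exact_mod_cast h0
    have := Nat.le_of_dvd (by norm_num) ((ZMod.natCast_eq_zero_iff 2 q).mp h0')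
    omega
  have h4e : (4 : ZMod q) ^ E = 1 := by
    rw [show (4 : ZMod q) = 2 ^ 2 by norm_num, ← pow_mul, show 2 * E = q - 1 by omega,
      ZMod.pow_card_sub_one_eq_one h2q]
  rw [← ZMod.intCast_zmod_eq_zero_iff_dvd]; push_cast
  rw [pow_mul, h4e, one_pow, sub_self]

/-- **`F(u) = F(−4/u)` at every odd prime-power level `p^e`.** [cite: Pollack2003, Conj. 6.3] -/
theorem chi_eq_of_b_neg_one_of_mul_d_eq_neg_four_primePow (hp : p.Prime) (hp2 : p ≠ 2) (he : 1 ≤ e)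
    (hadd : ∀ γ δ : Gamma0 (p ^ e), χ (γ * δ) = χ γ + χ δ)
    (hsmall : ∀ γ : Gamma0 (p ^ e), ((γ : SL(2, ℤ)) 0 0 + (γ : SL(2, ℤ)) 1 1).natAbs ≤ 2 → χ γ = 0)
    (hkill : ∀ γ : Gamma0 (p ^ e), (∃ k : ℕ, 1 ≤ k ∧ ((γ : SL(2, ℤ)) 1 1).natAbs = 4 ^ k) → χ γ = 0)
    {β β' : Gamma0 (p ^ e)} (hb : (β : SL(2, ℤ)) 0 1 = -1) (hb' : (β' : SL(2, ℤ)) 0 1 = -1)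
    (h : ((((β : SL(2, ℤ)) 1 1 : ℤ) : ZMod (p ^ e))) * ((((β' : SL(2, ℤ)) 1 1 : ℤ) : ZMod (p ^ e))) = -4) :
    χ β = χ β' := by
  have hp3 : 3 ≤ p := by
    rcases hp.eq_two_or_odd with h2 | h2
    · exact absurd h2 hp2
    · have := hp.two_le; omega
  have hN1 : 1 ≤ (p ^ e) := Nat.one_le_iff_ne_zero.mpr (NeZero.ne _)
  have hpN : p ∣ (p ^ e) := dvd_pow_self p (by omega)
  -- coprimalities with `(p ^ e) = p^e`
  have h2p : Nat.Coprime 2 p := (Nat.coprime_primes Nat.prime_two hp).mpr (Ne.symm hp2)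
  have h4N : Nat.Coprime 4 (p ^ e) := by
    rw [show (4 : ℕ) = 2 ^ 2 by norm_num]; exact (h2p.pow_left 2).pow_right e
  have hN4 : IsCoprime (4 : ℤ) ((p ^ e : ℕ) : ℤ) := by
    rw [show (4 : ℤ) = ((4 : ℕ) : ℤ) by norm_num]; exact Nat.isCoprime_iff_coprime.mpr h4N
  have hMN : Nat.Coprime (4 * (p - 1)) (p ^ e) := by
    apply Nat.Coprime.mul_left h4N
    apply Nat.Coprime.pow_right
    have : Nat.Coprime (p - 1) (p - 1 + 1) := Nat.coprime_self_add_right.mpr (Nat.coprime_one_right _)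
    rwa [Nat.sub_add_cancel (by omega)] at this
  -- Euler: `4^φ((p ^ e)) ≡ 1 (mod (p ^ e))`, `φ((p ^ e)) = p^(e-1) (p-1) ≥ 2`
  have hφ : Nat.totient (p ^ e) = p ^ (e - 1) * (p - 1) := Nat.totient_prime_pow hp (by omega)
  have hφ2 : 2 ≤ Nat.totient (p ^ e) := by
    rw [hφ]; exact le_trans (by omega : 2 ≤ p - 1) (Nat.le_mul_of_pos_left _ (Nat.pow_pos (by omega)))
  have h4φ : (4 : ZMod (p ^ e)) ^ Nat.totient (p ^ e) = 1 := by
    have := (ZMod.natCast_eq_natCast_iff _ _ _).mpr (Nat.ModEq.pow_totient h4N)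
    push_cast at this; exact this
  -- the unit `u = d(β)` and its residue mod `p`
  set d : ℤ := (β : SL(2, ℤ)) 1 1 with hd
  have hdu : IsUnit ((d : ℤ) : ZMod (p ^ e)) := isUnit_gamma0_apply_one_one β
  set b : ℕ := ((d : ℤ) : ZMod (p ^ e)).val with hbdef
  have hbN : Nat.Coprime b (p ^ e) := by
    have hh := ZMod.val_coe_unit_coprime hdu.unit
    rwa [IsUnit.unit_spec] at hh
  have hbcast : ((b : ℕ) : ZMod (p ^ e)) = ((d : ℤ) : ZMod (p ^ e)) := by rw [hbdef, ZMod.natCast_zmod_val]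
  -- Getting the witness `(δ, k)`: a natural `δ ≡ b (mod (p ^ e))` prime to nothing in particular, an exponent `E` prime to `φ((p ^ e))`
  -- with `δ ∣ 4^(E t) − 1` for all `t`.
  have key : ∃ δ E : ℕ, 1 ≤ E ∧ δ ≡ b [MOD (p ^ e)] ∧ Nat.Coprime E (Nat.totient (p ^ e)) ∧ ∀ t : ℕ, (δ : ℤ) ∣ 4 ^ (E * t) - 1 := by
    by_cases hb1 : b % p = 1
    · -- two primes in the classes `2` and `b/2`
      have h2N : Nat.Coprime 2 (p ^ e) := h2p.pow_right e
      obtain ⟨c₂, -, hc₂⟩ := Nat.exists_mul_mod_eq_of_coprime b h2N (by omega)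
      -- `2 c₂ ≡ b (mod (p ^ e))`
      have hc₂N : Nat.Coprime c₂ (p ^ e) := by
        have hprod : Nat.Coprime (2 * c₂) (p ^ e) := by
          have e1 : 2 * c₂ ≡ b [MOD (p ^ e)] := by
            unfold Nat.ModEq; rw [hc₂]
          rw [Nat.Coprime, e1.gcd_eq]; exact hbN
        exact Nat.Coprime.coprime_mul_left hprod |>.symm |> fun hh ↦ (Nat.Coprime.coprime_mul_right (by rwa [mul_comm] at hprod))
      obtain ⟨q₁, hq₁2, hq₁p, hq₁M, hq₁N⟩ := exists_prime_modEq_pair (4 * (p - 1)) (p ^ e) 2 2 (by omega) hN1 hMN h2N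
      obtain ⟨q₂, hq₂1, hq₂p, hq₂M, hq₂N⟩ := exists_prime_modEq_pair (4 * (p - 1)) (p ^ e) c₂ q₁ (by omega) hN1 hMN hc₂N
      obtain ⟨hE₁, hq₁e⟩ := coprime_half_pred_of_modEq (p - 1) q₁ (by omega) hq₁M (by omega)
      obtain ⟨hE₂, hq₂e⟩ := coprime_half_pred_of_modEq (p - 1) q₂ (by omega) hq₂M (by omega)
      set E₁ := (q₁ - 1) / 2
      set E₂ := (q₂ - 1) / 2
      -- `p ∤ E₁, E₂` since `q₁ ≡ 2`, `q₂ ≡ c₂ ≢ 1 (mod p)`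
      have hpE₁ : Nat.Coprime E₁ p := by
        refine (Nat.Prime.coprime_iff_not_dvd hp).mpr (fun hdvd ↦ ?_) |>.symm
        have e1 : q₁ ≡ 2 [MOD p] := hq₁N.of_dvd hpN
        have : p ∣ q₁ - 1 := by rw [show q₁ - 1 = 2 * E₁ by omega]; exact hdvd.mul_left 2
        have e2 : q₁ ≡ 1 [MOD p] :=
          (Nat.modEq_iff_dvd' (by omega)).mpr this |>.symm
        have e3 : 2 ≡ 1 [MOD p] := e1.symm.trans e2
        have := (Nat.modEq_iff_dvd' (by omega)).mp e3.symm
        exact absurd (Nat.le_of_dvd (by omega) this) (by omega)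
      have hpE₂ : Nat.Coprime E₂ p := by
        refine (Nat.Prime.coprime_iff_not_dvd hp).mpr (fun hdvd ↦ ?_) |>.symm
        have e1 : q₂ ≡ c₂ [MOD p] := hq₂N.of_dvd hpN
        have : p ∣ q₂ - 1 := by rw [show q₂ - 1 = 2 * E₂ by omega]; exact hdvd.mul_left 2
        have e2 : q₂ ≡ 1 [MOD p] := (Nat.modEq_iff_dvd' (by omega)).mpr this |>.symm
        have e3 : c₂ ≡ 1 [MOD p] := e1.symm.trans e2
        -- then `b ≡ 2 c₂ ≡ 2 (mod p)` contradicting `b ≡ 1 (mod p)` and `p ≥ 3`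
        have e4 : 2 * c₂ ≡ 2 [MOD p] := by simpa using e3.mul_left 2
        have e5 : 2 * c₂ ≡ b [MOD p] := by
          have : 2 * c₂ ≡ b [MOD (p ^ e)] := by unfold Nat.ModEq; rw [hc₂]
          exact this.of_dvd hpN
        have e6 : b ≡ 1 [MOD p] := by unfold Nat.ModEq; rw [hb1, Nat.mod_eq_of_lt (by omega : 1 < p)]
        have e7 : 2 ≡ 1 [MOD p] := (e4.symm.trans e5).trans e6
        have := (Nat.modEq_iff_dvd' (by omega)).mp e7.symm
        exact absurd (Nat.le_of_dvd (by omega) this) (by omega)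
      refine ⟨q₁ * q₂, E₁ * E₂, Nat.one_le_iff_ne_zero.mpr (Nat.mul_ne_zero (by omega) (by omega)), ?_, ?_, ?_⟩
      · -- `q₁ q₂ ≡ 2 c₂ ≡ b`
        have : q₁ * q₂ ≡ 2 * c₂ [MOD (p ^ e)] := hq₁N.mul hq₂N
        exact this.trans (by unfold Nat.ModEq; rw [hc₂])
      · rw [hφ]
        apply Nat.Coprime.mul_right
        · exact (Nat.Coprime.mul_left hpE₁ hpE₂).pow_right _
        · exact Nat.Coprime.mul_left hE₁ hE₂
      · intro t
        have hne : q₁ ≠ q₂ := by omega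
        have hcop : IsCoprime (q₁ : ℤ) (q₂ : ℤ) :=
          Nat.isCoprime_iff_coprime.mpr ((Nat.coprime_primes hq₁p hq₂p).mpr hne)
        have d1 : (q₁ : ℤ) ∣ 4 ^ (E₁ * E₂ * t) - 1 := by
          rw [mul_assoc]; exact int_prime_dvd_four_pow_sub_one hq₁p hq₁2 E₁ (E₂ * t) hq₁e
        have d2 : (q₂ : ℤ) ∣ 4 ^ (E₁ * E₂ * t) - 1 := by
          rw [mul_comm E₁ E₂, mul_assoc]
          exact int_prime_dvd_four_pow_sub_one hq₂p (by omega) E₂ (E₁ * t) hq₂e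
        push_cast
        exact hcop.mul_dvd d1 d2
    · -- one prime in the class `b`
      obtain ⟨q, hq2, hqp, hqM, hqN⟩ := exists_prime_modEq_pair (4 * (p - 1)) (p ^ e) b 2 (by omega) hN1 hMN hbN
      obtain ⟨hE, hqe⟩ := coprime_half_pred_of_modEq (p - 1) q (by omega) hqM (by omega)
      set E := (q - 1) / 2
      have hpE : Nat.Coprime E p := by
        refine (Nat.Prime.coprime_iff_not_dvd hp).mpr (fun hdvd ↦ ?_) |>.symm
        have e1 : q ≡ b [MOD p] := hqN.of_dvd hpN
        have : p ∣ q - 1 := by rw [show q - 1 = 2 * E by omega]; exact hdvd.mul_left 2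
        have e2 : q ≡ 1 [MOD p] := (Nat.modEq_iff_dvd' (by omega)).mpr this |>.symm
        have e3 : b ≡ 1 [MOD p] := e1.symm.trans e2
        exact hb1 (by unfold Nat.ModEq at e3; rw [e3, Nat.mod_eq_of_lt (by omega : 1 < p)])
      refine ⟨q, E, by omega, hqN, ?_, fun t ↦ int_prime_dvd_four_pow_sub_one hqp hq2 E t hqe⟩
      rw [hφ]
      exact Nat.Coprime.mul_right (hpE.pow_right _) hE
  obtain ⟨δ, E, hE1, hδb, hEφ, hδdvd⟩ := key
  -- `s` with `E s ≡ 1 (mod φ (p ^ e))`, `k := E s`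
  obtain ⟨s, -, hs⟩ := Nat.exists_mul_mod_eq_one_of_coprime hEφ (by omega)
  have hs1 : 1 ≤ s := by
    rcases Nat.eq_zero_or_pos s with h0 | h0
    · rw [h0, mul_zero, Nat.zero_mod] at hs; omega
    · exact h0
  set k : ℕ := E * s with hk
  have hk1 : 1 ≤ k := Nat.one_le_iff_ne_zero.mpr (Nat.mul_ne_zero (by omega) (by omega))
  have hNk : (4 : ZMod (p ^ e)) ^ k = 4 := by
    have hdecomp : k = 1 + Nat.totient (p ^ e) * (k / Nat.totient (p ^ e)) := by
      have := Nat.div_add_mod k (Nat.totient (p ^ e))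
      rw [hk] at this ⊢; rw [hs] at this; omega
    rw [hdecomp, pow_add, pow_one, pow_mul, h4φ, one_pow, mul_one]
  exact chi_eq_of_b_neg_one_of_witness hN4 hadd hsmall hkill hb hb' h (δ : ℤ)
    (by rw [Int.cast_natCast, (ZMod.natCast_eq_natCast_iff _ _ _).mpr hδb, hbcast]) k hk1 (hδdvd s) hNk

/-- **`F(4u) = F(u)` at every odd prime-power level.** [cite: Pollack2003, Conj. 6.3] -/
theorem chi_eq_of_b_neg_one_of_d_eq_four_mul_primePow (hp : p.Prime) (hp2 : p ≠ 2) (he : 1 ≤ e)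
    (hadd : ∀ γ δ : Gamma0 (p ^ e), χ (γ * δ) = χ γ + χ δ)
    (hsmall : ∀ γ : Gamma0 (p ^ e), ((γ : SL(2, ℤ)) 0 0 + (γ : SL(2, ℤ)) 1 1).natAbs ≤ 2 → χ γ = 0)
    (hkill : ∀ γ : Gamma0 (p ^ e), (∃ k : ℕ, 1 ≤ k ∧ ((γ : SL(2, ℤ)) 1 1).natAbs = 4 ^ k) → χ γ = 0)
    {β β' : Gamma0 (p ^ e)} (hb : (β : SL(2, ℤ)) 0 1 = -1) (hb' : (β' : SL(2, ℤ)) 0 1 = -1)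
    (h : ((((β : SL(2, ℤ)) 1 1 : ℤ) : ZMod (p ^ e))) = 4 * ((((β' : SL(2, ℤ)) 1 1 : ℤ) : ZMod (p ^ e)))) :
    χ β = χ β' := by
  have hu := isUnit_gamma0_apply_one_one β'
  obtain ⟨β₁, hb1, hd1⟩ := exists_b_neg_one_of_isUnit (N := p ^ e) (hu.unit⁻¹).isUnit.neg
  have e1 : ((((β : SL(2, ℤ)) 1 1 : ℤ) : ZMod (p ^ e))) * ((((β₁ : SL(2, ℤ)) 1 1 : ℤ) : ZMod (p ^ e))) = -4 := by
    rw [h, hd1, mul_neg, mul_assoc, IsUnit.mul_val_inv, mul_one]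
  have e2 : ((((β₁ : SL(2, ℤ)) 1 1 : ℤ) : ZMod (p ^ e))) * ((((β' : SL(2, ℤ)) 1 1 : ℤ) : ZMod (p ^ e))) = -1 := by
    rw [hd1, neg_mul, IsUnit.val_inv_mul]
  rw [chi_eq_of_b_neg_one_of_mul_d_eq_neg_four_primePow hp hp2 he hadd hsmall hkill hb hb1 e1,
    chi_eq_of_b_neg_one_of_mul_d_eq_neg_one hadd hsmall hb1 hb' e2]

end PrimePow

end Summit.BirchSwinnertonDyer.BirchSwinnertonDyer.Theorems.SignedMuAtTwo
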